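import Summits.Ventures.PercRepro.SMC
import Summits.Ventures.PercRepro.SMC3Proof

/-!
# C-012: exact forms of the slack and the Harris-only partial theorem

Row C-012 (`PercRepro.C012`, typer-2 SMC.lean): on the five rows `x = P(abc), y₁ = P(ab|c),
y₂ = P(ac|b), y₃ = P(bc|a), z = P(a|b|c)`, `(z + y₁)(y₂ + x) ≤ (y₁ + y₂ + y₃)(x + z)`.

* `c012_slack_eq`: the slack is `z·(y₁ + y₃ − x) + y₂·(x − y₁) + y₃·x`
  (and `= y₃(x + z) + (x − y₁)(y₂ − z)`), so it is a sum of nonnegative terms unless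
  `P(abc) > P(ab|c) + P(bc|a)`.
* `MultiGraph.c012_harris`: the one Harris inequality the partial theorem needs, in row form:
  `y₂ · (x + y₁) ≤ x · (y₂ + z)` (`{a ~ c}` increasing, `{b isolated from a, c}` decreasing).
* `MultiGraph.c012_of_le` / `MultiGraph.c012_of_not_hard`: **C-012 holds whenever
  `P(abc) ≤ P(ab|c) + P(bc|a)`**, and more generally unless `P(abc) > P(ab|c) + P(bc|a)` and
  `P(a|b|c) > P(ac|b)` (the HARD CASE); `C012_of_hard` reduces the row to that case.

Paper note: `proofs/P5-C012.md` (§1–§2). Everything here is Harris + algebra; the hard case is open.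
-/

namespace PercRepro

open Finset

/-- The C-012 slack in the form `z·(y₁ + y₃ − x) + y₂·(x − y₁) + y₃·x`. -/
theorem c012_slack_eq (x y₁ y₂ y₃ z : ℝ) :
    (y₁ + y₂ + y₃) * (x + z) - (z + y₁) * (y₂ + x) =
      z * (y₁ + y₃ - x) + y₂ * (x - y₁) + y₃ * x := by ring

/-- The C-012 slack in the form `y₃·(x + z) + (x − y₁)·(y₂ − z)`. -/
theorem c012_slack_eq' (x y₁ y₂ y₃ z : ℝ) :
    (y₁ + y₂ + y₃) * (x + z) - (z + y₁) * (y₂ + x) =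
      y₃ * (x + z) + (x - y₁) * (y₂ - z) := by ring

/-- Pure real arithmetic behind the partial theorem: nonnegative reals with
`y₂·(x + y₁) ≤ x·(y₂ + z)` (Harris) and `x ≤ y₁ + y₃` satisfy C-012 (`y₁ ≥ 0` is not needed). -/
theorem c012_real_of_le {x y₁ y₂ y₃ z : ℝ} (hx : 0 ≤ x) (hy₂ : 0 ≤ y₂)
    (hy₃ : 0 ≤ y₃) (hz : 0 ≤ z) (hH : y₂ * (x + y₁) ≤ x * (y₂ + z))
    (h : x ≤ y₁ + y₃) :
    (z + y₁) * (y₂ + x) ≤ (y₁ + y₂ + y₃) * (x + z) := by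
  rw [← sub_nonneg, c012_slack_eq]
  rcases le_or_gt y₁ x with hxy | hxy
  · have h1 : 0 ≤ z * (y₁ + y₃ - x) := mul_nonneg hz (by linarith)
    have h2 : 0 ≤ y₂ * (x - y₁) := mul_nonneg hy₂ (by linarith)
    nlinarith [mul_nonneg hy₃ hx]
  · -- `x < y₁`: Harris gives `y₂ ≤ z`, and the slack is `(y₁ − x)(z − y₂) + y₃(x + z)`.
    have hy₁pos : 0 < y₁ := lt_of_le_of_lt hx hxy
    have hzy : y₂ ≤ z := by
      -- `y₂ y₁ ≤ x z ≤ y₁ z`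
      have h1 : y₂ * y₁ ≤ x * z := by nlinarith
      have h2 : x * z ≤ y₁ * z := mul_le_mul_of_nonneg_right hxy.le hz
      have h3 : y₁ * y₂ ≤ y₁ * z := by nlinarith
      exact le_of_mul_le_mul_left h3 hy₁pos
    have h4 : 0 ≤ (y₁ - x) * (z - y₂) := mul_nonneg (by linarith) (by linarith)
    nlinarith [mul_nonneg hy₃ hx, mul_nonneg hy₃ hz]

/-- Pure real arithmetic: C-012 holds unless `y₁ + y₃ < x` and `y₂ < z` (the hard case). -/
theorem c012_real_of_not_hard {x y₁ y₂ y₃ z : ℝ} (hx : 0 ≤ x) (hy₂ : 0 ≤ y₂)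
    (hy₃ : 0 ≤ y₃) (hz : 0 ≤ z) (hH : y₂ * (x + y₁) ≤ x * (y₂ + z))
    (h : ¬ (y₁ + y₃ < x ∧ y₂ < z)) :
    (z + y₁) * (y₂ + x) ≤ (y₁ + y₂ + y₃) * (x + z) := by
  rcases le_or_gt x (y₁ + y₃) with hle | hlt
  · exact c012_real_of_le hx hy₂ hy₃ hz hH hle
  · have hzy : z ≤ y₂ := by
      by_contra hcon
      exact h ⟨hlt, lt_of_not_ge hcon⟩
    rw [← sub_nonneg, c012_slack_eq']
    have h1 : 0 ≤ (x - y₁) * (y₂ - z) := mul_nonneg (by linarith) (by linarith)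
    nlinarith [mul_nonneg hy₃ hx, mul_nonneg hy₃ hz]

namespace MultiGraph

variable {E : Type*} [Fintype E] [DecidableEq E] {V : Type*} (G : MultiGraph V E)

omit [Fintype E] [DecidableEq E] in
/-- `{a ~ c} ∩ {b isolated from a and c} = {a ~ c ∧ a ≁ b}` (transitivity). -/
theorem connEvent_inter_biso (a b c : V) :
    G.connEvent a c ∩ (G.sepEvent a b ∩ G.sepEvent b c) = G.connEvent a c ∩ G.sepEvent a b := by
  ext ω
  simp only [Set.mem_inter_iff, mem_connEvent, mem_sepEvent]
  constructor
  · rintro ⟨hac, hab, _⟩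
    exact ⟨hac, hab⟩
  · rintro ⟨hac, hab⟩
    exact ⟨hac, hab, fun hbc => hab (hac.trans hbc.symm)⟩

omit [Fintype E] [DecidableEq E] in
/-- `{a ~ c} ∩ {a ~ b} = {a ~ b} ∩ {b ~ c}` (transitivity). -/
theorem connEvent_ac_inter_ab (a b c : V) :
    G.connEvent a c ∩ G.connEvent a b = G.connEvent a b ∩ G.connEvent b c := by
  ext ω
  simp only [Set.mem_inter_iff, mem_connEvent]
  constructor
  · rintro ⟨hac, hab⟩
    exact ⟨hab, hab.symm.trans hac⟩
  · rintro ⟨hab, hbc⟩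
    exact ⟨hab.trans hbc, hab⟩

/-- `P(a ~ c) = x + y₂` in the rows of `triLaw`. -/
theorem prob_connEvent_ac_eq (p : E → ℝ) (a b c : V) :
    prob p (G.connEvent a c) = G.triLaw p a b c 0 + G.triLaw p a b c 2 := by
  have h := prob_inter_add_prob_inter_compl p (G.connEvent a c) (G.connEvent a b)
  rw [connEvent_ac_inter_ab] at h
  rw [← h]
  rfl

/-- `P(b isolated from a and c) = y₂ + z` in the rows of `triLaw`. -/
theorem prob_biso_eq (p : E → ℝ) (a b c : V) :
    prob p (G.sepEvent a b ∩ G.sepEvent b c) = G.triLaw p a b c 2 + G.triLaw p a b c 4 := by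
  have h := prob_inter_add_prob_inter_compl p (G.sepEvent a b ∩ G.sepEvent b c)
    (G.connEvent a c)
  rw [Set.inter_comm, connEvent_inter_biso] at h
  rw [← h]
  rfl

/-- **The Harris inequality behind the partial theorem**, in row form:
`y₂ · (x + y₁) ≤ x · (y₂ + z)`. (From `P({a ~ c} ∩ {b iso}) ≤ P(a ~ c) · P(b iso)` with
`P(b iso)ᶜ ≥ P(a ~ b) = x + y₁`.) -/
theorem c012_harris {p : E → ℝ} (hp : IsProb p) (a b c : V) :
    G.triLaw p a b c 2 * (G.triLaw p a b c 0 + G.triLaw p a b c 1) ≤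
      G.triLaw p a b c 0 * (G.triLaw p a b c 2 + G.triLaw p a b c 4) := by
  have hJ : IsLowerSet (G.sepEvent a b ∩ G.sepEvent b c) :=
    (G.isLowerSet_sepEvent a b).inter (G.isLowerSet_sepEvent b c)
  have hH := harris_upper_lower hp (G.isUpperSet_connEvent a c) hJ
  rw [connEvent_inter_biso, prob_connEvent_ac_eq (b := b), prob_biso_eq] at hH
  -- `P(b iso)ᶜ ≥ P(a ~ b)`
  have hsub : G.connEvent a b ⊆ (G.sepEvent a b ∩ G.sepEvent b c)ᶜ := by
    intro ω hω hmem
    exact hmem.1 hω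
  have hmono := prob_mono hp hsub
  rw [prob_compl, prob_biso_eq] at hmono
  have hab : prob p (G.connEvent a b) = G.triLaw p a b c 0 + G.triLaw p a b c 1 := by
    have h := prob_inter_add_prob_inter_compl p (G.connEvent a b) (G.connEvent b c)
    rw [← h]
    rfl
  rw [hab] at hmono
  have hy₂ : 0 ≤ G.triLaw p a b c 2 := prob_nonneg hp _
  have hx : 0 ≤ G.triLaw p a b c 0 := prob_nonneg hp _
  have e2 : G.triLaw p a b c 2 = prob p (G.connEvent a c ∩ G.sepEvent a b) := rfl
  rw [← e2] at hH
  nlinarith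

/-- **C-012 holds whenever `P(abc) ≤ P(ab|c) + P(bc|a)`** (Harris + algebra), in the row
form of `PercRepro.C012`. -/
theorem c012_of_le {p : E → ℝ} (hp : IsProb p) (a b c : V)
    (h : G.law3 p a b c 0 ≤ G.law3 p a b c 1 + G.law3 p a b c 3) :
    (G.law3 p a b c 4 + G.law3 p a b c 1) * (G.law3 p a b c 2 + G.law3 p a b c 0) ≤
      (G.law3 p a b c 1 + G.law3 p a b c 2 + G.law3 p a b c 3) *
        (G.law3 p a b c 0 + G.law3 p a b c 4) := by
  rw [law3_eq_triLaw] at h ⊢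
  exact c012_real_of_le (prob_nonneg hp _) (prob_nonneg hp _)
    (prob_nonneg hp _) (prob_nonneg hp _) (G.c012_harris hp a b c) h

/-- **C-012 holds unless `P(abc) > P(ab|c) + P(bc|a)` and `P(a|b|c) > P(ac|b)`** — the
hard case is the only open case of the row. -/
theorem c012_of_not_hard {p : E → ℝ} (hp : IsProb p) (a b c : V)
    (h : ¬ (G.law3 p a b c 1 + G.law3 p a b c 3 < G.law3 p a b c 0 ∧
      G.law3 p a b c 2 < G.law3 p a b c 4)) :
    (G.law3 p a b c 4 + G.law3 p a b c 1) * (G.law3 p a b c 2 + G.law3 p a b c 0) ≤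
      (G.law3 p a b c 1 + G.law3 p a b c 2 + G.law3 p a b c 3) *
        (G.law3 p a b c 0 + G.law3 p a b c 4) := by
  rw [law3_eq_triLaw] at h ⊢
  exact c012_real_of_not_hard (prob_nonneg hp _) (prob_nonneg hp _)
    (prob_nonneg hp _) (prob_nonneg hp _) (G.c012_harris hp a b c) h

end MultiGraph

/-- The row C-012 reduces to its hard case: it suffices to prove the inequality on every
marked multigraph with `P(abc) > P(ab|c) + P(bc|a)` and `P(a|b|c) > P(ac|b)`. -/
theorem C012_of_hard
    (hhard : ∀ {V E : Type} [Fintype E] [DecidableEq E] (G : MultiGraph V E) (p : E → ℝ),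
      IsProb p → ∀ a b c : V,
        G.law3 p a b c 1 + G.law3 p a b c 3 < G.law3 p a b c 0 →
        G.law3 p a b c 2 < G.law3 p a b c 4 →
        (G.law3 p a b c 4 + G.law3 p a b c 1) * (G.law3 p a b c 2 + G.law3 p a b c 0) ≤
          (G.law3 p a b c 1 + G.law3 p a b c 2 + G.law3 p a b c 3) *
            (G.law3 p a b c 0 + G.law3 p a b c 4)) :
    C012 := by
  intro V E _ _ G p hp a b c
  by_cases h : G.law3 p a b c 1 + G.law3 p a b c 3 < G.law3 p a b c 0 ∧
      G.law3 p a b c 2 < G.law3 p a b c 4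
  · exact hhard G p hp a b c h.1 h.2
  · exact G.c012_of_not_hard hp a b c h

end PercRepro
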